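import Literature.Analysis.Convexity.AnisotropicPerimeterTransform
import Literature.Analysis.Convexity.AnisotropicPerimeterSeparated
import HarnessLib

/-!
# The localized anisotropic perimeter `P_K(A; U)` — test fields supported inside `U` — and its transformation rules

Topic `Literature/Analysis/Convexity`; namespace `Literature.Analysis.Convexity`. Companion of
`AnisotropicPerimeter.lean` (`anisotropicPerimeter K A = sup {∫_A div φ : φ ∈ C¹_c, φ(x) ∈ K}` and the
isotropic relative perimeter `relPerimeter A U`), `AnisotropicPerimeterTransform.lean` (translations /
isometries / dilations of the GLOBAL `K`-perimeter) and `AnisotropicPerimeterSeparated.lean` (locality: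
`anisotropicPerimeter_eq_iSup_tsupport_subset`).

Maggi's anisotropic surface energy is a Borel measure `F ↦ Φ(E; F) = ∫_{F ∩ ∂*E} Φ(ν_E) dH^{n−1}`
((20.2) p. 258); for an OPEN `F` its distributional form is the supremum of `∫_E div φ` over the admissible
fields COMPACTLY SUPPORTED INSIDE `F` (as for the perimeter `P(E; F)`, (12.2)–(12.3) p. 122, and
Alicandro–Braides–Cicalese–Solci's `Per(A; U)`, Remark 2.14).  This file NAMES that localized supremum,

  `anisotropicPerimeterIn K A U := ⨆ φ ∈ C¹_c(V;V), φ(x) ∈ K, tsupport φ ⊆ U, ofReal (∫_A div φ)`,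

with EXACTLY the binder shape of the right-hand side of `anisotropicPerimeter_eq_iSup_tsupport_subset` (and
of the Crystal3D texture line's `perKIn K G U`, which is therefore `rfl`-equal to it), and proves the
bookkeeping a consumer needs when a localized certificate is moved rigidly or rescaled:

* definition unfolding `le_anisotropicPerimeterIn`, `anisotropicPerimeterIn_le_iff`; monotonicity in `U`
  and in `K`; `anisotropicPerimeterIn_le` (`≤ P_K(A)`), `anisotropicPerimeterIn_univ` (`= P_K(A)`);
  `relPerimeter_eq_anisotropicPerimeterIn_closedBall`; null modifications `anisotropicPerimeterIn_congr_ae`,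
  `anisotropicPerimeterIn_of_volume_eq_zero`, `anisotropicPerimeterIn_empty`;
* locality restated: `anisotropicPerimeterIn_eq_anisotropicPerimeter` (`U` open `⊇ closure A`, `K` convex `∋ 0`);
* **transformation rules** (the localized forms of Maggi Ex. 12.8 / 12.11): `anisotropicPerimeterIn_vadd`
  (`P_K(a + A; a + U) = P_K(A; U)`), `anisotropicPerimeterIn_image_linearIsometryEquiv`
  (`P_{gK}(gA; gU) = P_K(A; U)`), `…_of_image_eq` (`gK = K`), `anisotropicPerimeterIn_rigidMotion`
  (`x ↦ g x + u`), `anisotropicPerimeterIn_smul` (`P_K(rA; rU) = r^{d−1} P_K(A; U)`, `r > 0`).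

Test fields transform as in `AnisotropicPerimeterTransform.lean` (`φ ↦ φ(· + a)`, `φ ↦ g⁻¹ ∘ φ ∘ g`,
`φ ↦ φ(r ·)`); the only new point is that these substitutions carry `tsupport φ ⊆ (moved U)` to
`tsupport ψ ⊆ U` (`tsupport_comp_eq_preimage`).  No new facts; one definition with a body.

## References
* F. Maggi, *Sets of Finite Perimeter and Geometric Variational Problems*, CUP 2012: (12.2)–(12.3) p. 122
  (perimeter relative to an open set), Exercises 12.8, 12.11 p. 123, (20.2) p. 258. [`Maggi2012`]
* R. Alicandro, A. Braides, M. Cicalese, M. Solci, *Discrete Variational Problems with Interfaces*, CUP 2023,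
  Remark 2.14 pp. 53–54 (`Per(A; U)`). [`AlicandroBraidesCicaleseSolci2023`]
-/

noncomputable section

open Set Filter Function Metric
open _root_.MeasureTheory _root_.MeasureTheory.Measure
open scoped ENNReal NNReal Topology Pointwise

namespace Literature.Analysis.Convexity

open Literature.MathematicalPhysics.StatisticalMechanics (fieldDivergence perimeter IsUnitTestField)

variable {V : Type*} [NormedAddCommGroup V] [InnerProductSpace ℝ V] [FiniteDimensional ℝ V]
  [MeasurableSpace V] [BorelSpace V]

/-! ### Definition and unfolding -/

/-- **The localized `K`-perimeter `P_K(A; U)`**: the supremum of `∫_A div φ` over `C¹` compactly supported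
fields `φ` with values in `K` AND topological support inside `U` (Maggi's `Φ(E; F)` for open `F`, in the
distributional form of (12.2)–(12.3); the Crystal3D texture line's `perKIn K A U` verbatim).
[cite: Maggi2012, (20.2) p. 258 and (12.2)–(12.3) p. 122]
[cite: AlicandroBraidesCicaleseSolci2023, Remark 2.14 pp. 53–54] -/
def anisotropicPerimeterIn (K A U : Set V) : ℝ≥0∞ :=
  ⨆ (φ : V → V) (_ : ContDiff ℝ 1 φ ∧ HasCompactSupport φ ∧ (∀ x, φ x ∈ K) ∧ tsupport φ ⊆ U),
    ENNReal.ofReal (∫ x in A, fieldDivergence φ x)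

/-- Every admissible field supported in `U` bounds `P_K(A; U)` from below (definition).
[cite: Maggi2012, (12.2) p. 122] -/
theorem le_anisotropicPerimeterIn {K A U : Set V} {φ : V → V} (h₁ : ContDiff ℝ 1 φ)
    (h₂ : HasCompactSupport φ) (h₃ : ∀ x, φ x ∈ K) (hU : tsupport φ ⊆ U) :
    ENNReal.ofReal (∫ x in A, fieldDivergence φ x) ≤ anisotropicPerimeterIn K A U :=
  le_iSup₂ (f := fun (φ : V → V)
      (_ : ContDiff ℝ 1 φ ∧ HasCompactSupport φ ∧ (∀ x, φ x ∈ K) ∧ tsupport φ ⊆ U) =>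
    ENNReal.ofReal (∫ x in A, fieldDivergence φ x)) φ ⟨h₁, h₂, h₃, hU⟩

/-- `P_K(A; U) ≤ c` iff every admissible field supported in `U` has `∫_A div φ ≤ c` (definition).
[cite: Maggi2012, (12.2) p. 122] -/
theorem anisotropicPerimeterIn_le_iff {K A U : Set V} {c : ℝ≥0∞} :
    anisotropicPerimeterIn K A U ≤ c ↔
      ∀ φ : V → V, ContDiff ℝ 1 φ → HasCompactSupport φ → (∀ x, φ x ∈ K) → tsupport φ ⊆ U →
        ENNReal.ofReal (∫ x in A, fieldDivergence φ x) ≤ c := by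
  rw [anisotropicPerimeterIn, iSup₂_le_iff]
  exact ⟨fun h φ h₁ h₂ h₃ h₄ => h φ ⟨h₁, h₂, h₃, h₄⟩, fun h φ hφ => h φ hφ.1 hφ.2.1 hφ.2.2.1 hφ.2.2.2⟩

/-- `P_K(A; U)` is monotone in `U` (fewer admissible fields on a smaller set).
[cite: AlicandroBraidesCicaleseSolci2023, Remark 2.14 p. 54] -/
theorem anisotropicPerimeterIn_mono (K A : Set V) {U U' : Set V} (h : U ⊆ U') :
    anisotropicPerimeterIn K A U ≤ anisotropicPerimeterIn K A U' :=
  anisotropicPerimeterIn_le_iff.2 fun _ h₁ h₂ h₃ h₄ => le_anisotropicPerimeterIn h₁ h₂ h₃ (h₄.trans h)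

/-- `P_K(A; U)` is monotone in the constraint body `K`. [cite: Maggi2012, (20.2) p. 258] -/
theorem anisotropicPerimeterIn_mono_left {K K' : Set V} (h : K ⊆ K') (A U : Set V) :
    anisotropicPerimeterIn K A U ≤ anisotropicPerimeterIn K' A U :=
  anisotropicPerimeterIn_le_iff.2 fun _ h₁ h₂ h₃ h₄ =>
    le_anisotropicPerimeterIn h₁ h₂ (fun x => h (h₃ x)) h₄

/-- `P_K(A; U) ≤ P_K(A)` (drop the support constraint). [cite: Maggi2012, (12.2)–(12.3) p. 122] -/
theorem anisotropicPerimeterIn_le (K A U : Set V) :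
    anisotropicPerimeterIn K A U ≤ anisotropicPerimeter K A :=
  anisotropicPerimeterIn_le_iff.2 fun _ h₁ h₂ h₃ _ => le_anisotropicPerimeter h₁ h₂ h₃

/-- `P_K(A; V) = P_K(A)` (no constraint on the support). [cite: Maggi2012, (12.2)–(12.3) p. 122] -/
theorem anisotropicPerimeterIn_univ (K A : Set V) :
    anisotropicPerimeterIn K A univ = anisotropicPerimeter K A :=
  le_antisymm (anisotropicPerimeterIn_le K A _)
    (anisotropicPerimeter_le_iff.2 fun _ h₁ h₂ h₃ => le_anisotropicPerimeterIn h₁ h₂ h₃ (subset_univ _))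

/-- The isotropic relative perimeter is the localized `K`-perimeter for `K` the closed unit ball:
`Per(A; U) = P_{B̄(0,1)}(A; U)`. [cite: AlicandroBraidesCicaleseSolci2023, Remark 2.14 pp. 53–54] -/
theorem relPerimeter_eq_anisotropicPerimeterIn_closedBall (A U : Set V) :
    relPerimeter A U = anisotropicPerimeterIn (closedBall (0 : V) 1) A U := by
  refine le_antisymm ?_ ?_
  · refine iSup₂_le fun φ hφ => ?_
    exact le_anisotropicPerimeterIn hφ.1.1 hφ.1.2.1 (fun x => by simpa using hφ.1.2.2 x) hφ.2
  · refine anisotropicPerimeterIn_le_iff.2 fun φ h₁ h₂ h₃ h₄ => ?_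
    exact le_relPerimeter ⟨h₁, h₂, fun x => by simpa using h₃ x⟩ h₄

/-- **Locality, restated**: for measurable `A`, open `U ⊇ closure A` and convex `K ∋ 0`,
`P_K(A; U) = P_K(A)` (cut-off argument of `anisotropicPerimeter_eq_iSup_tsupport_subset`).
[cite: Maggi2012, Exercise 12.16 p. 125 (locality of perimeter) and (12.6)] -/
theorem anisotropicPerimeterIn_eq_anisotropicPerimeter {K : Set V} (hKc : Convex ℝ K)
    (h0K : (0 : V) ∈ K) {A U : Set V} (hA : MeasurableSet A) (hU : IsOpen U)
    (hAU : closure A ⊆ U) :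
    anisotropicPerimeterIn K A U = anisotropicPerimeter K A :=
  (anisotropicPerimeter_eq_iSup_tsupport_subset hKc h0K hA hU hAU).symm

/-! ### Null modifications -/

/-- `P_K(A; U)` depends only on the Lebesgue class of `A`. [cite: Maggi2012, Exercise 12.16 p. 125] -/
theorem anisotropicPerimeterIn_congr_ae {A B : Set V} (h : A =ᵐ[volume] B) (K U : Set V) :
    anisotropicPerimeterIn K A U = anisotropicPerimeterIn K B U := by
  unfold anisotropicPerimeterIn
  simp_rw [setIntegral_congr_set h]

/-- A null set has `P_K(A; U) = 0`. [cite: Maggi2012, Exercise 12.16 p. 125] -/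
theorem anisotropicPerimeterIn_of_volume_eq_zero {A : Set V} (hA : volume A = 0) (K U : Set V) :
    anisotropicPerimeterIn K A U = 0 := by
  refine le_antisymm (anisotropicPerimeterIn_le_iff.2 fun φ _ _ _ _ => ?_) bot_le
  rw [setIntegral_measure_zero _ hA, ENNReal.ofReal_zero]

/-- `P_K(∅; U) = 0`. [cite: Maggi2012, (12.2) p. 122] -/
@[simp] theorem anisotropicPerimeterIn_empty (K U : Set V) : anisotropicPerimeterIn K ∅ U = 0 :=
  anisotropicPerimeterIn_of_volume_eq_zero measure_empty K U

/-! ### Translations -/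

omit [InnerProductSpace ℝ V] [FiniteDimensional ℝ V] [MeasurableSpace V] [BorelSpace V] in
/-- The support of `φ(· + a)` lies in `U` when the support of `φ` lies in `a + U`. [folklore] -/
private theorem tsupport_comp_add_subset {φ : V → V} {U : Set V} (a : V) (hU : tsupport φ ⊆ a +ᵥ U) :
    tsupport (fun y => φ (y + a)) ⊆ U := by
  have h : (fun y => φ (y + a)) = φ ∘ (Homeomorph.addRight a) := rfl
  rw [h, tsupport_comp_eq_preimage]
  intro y hy
  obtain ⟨u, hu, hux⟩ := Set.mem_vadd_set.1 (hU hy)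
  have : u = y := by
    have h' : a + u = y + a := by simpa [vadd_eq_add] using hux
    have := congrArg (fun z => z - a) h'
    simpa [add_sub_cancel_left, add_sub_cancel_right, add_comm] using this
  exact this ▸ hu

/-- One inequality of translation invariance. [cite: Maggi2012, Exercise 12.8 p. 123] -/
private theorem anisotropicPerimeterIn_vadd_le (K A U : Set V) (a : V) :
    anisotropicPerimeterIn K (a +ᵥ A) (a +ᵥ U) ≤ anisotropicPerimeterIn K A U := by
  refine anisotropicPerimeterIn_le_iff.2 fun φ h₁ h₂ h₃ h₄ => ?_
  -- translate the field: `ψ(y) = φ(y + a)`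
  have hψ₁ : ContDiff ℝ 1 fun y => φ (y + a) := h₁.comp (contDiff_id.add contDiff_const)
  have hψ₂ : HasCompactSupport fun y => φ (y + a) := h₂.comp_homeomorph (Homeomorph.addRight a)
  have hψ₃ : ∀ y, (fun y => φ (y + a)) y ∈ K := fun y => h₃ _
  have hψ₄ : tsupport (fun y => φ (y + a)) ⊆ U := tsupport_comp_add_subset a h₄
  have hmp : MeasurePreserving (fun y : V => a + y) volume volume := measurePreserving_add_left volume a
  have hme : MeasurableEmbedding fun y : V => a + y := (Homeomorph.addLeft a).measurableEmbedding
  have hset : a +ᵥ A = (fun y : V => a + y) '' A := by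
    rw [← Set.image_vadd]; rfl
  have hint : ∫ x in a +ᵥ A, fieldDivergence φ x =
      ∫ y in A, fieldDivergence (fun y => φ (y + a)) y := by
    rw [hset, hmp.setIntegral_image_emb hme]
    refine integral_congr_ae (Eventually.of_forall fun y => ?_)
    simp only
    rw [fieldDivergence_comp_add_right, add_comm]
  rw [hint]
  exact le_anisotropicPerimeterIn hψ₁ hψ₂ hψ₃ hψ₄

/-- **Translation invariance of the localized perimeter: `P_K(a + A; a + U) = P_K(A; U)`.**
[cite: Maggi2012, Exercise 12.8 p. 123] -/
theorem anisotropicPerimeterIn_vadd (K A U : Set V) (a : V) :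
    anisotropicPerimeterIn K (a +ᵥ A) (a +ᵥ U) = anisotropicPerimeterIn K A U := by
  refine le_antisymm (anisotropicPerimeterIn_vadd_le K A U a) ?_
  have h := anisotropicPerimeterIn_vadd_le K (a +ᵥ A) (a +ᵥ U) (-a)
  rwa [neg_vadd_vadd, neg_vadd_vadd] at h

/-! ### Linear isometries -/

omit [FiniteDimensional ℝ V] [MeasurableSpace V] [BorelSpace V] in
/-- A linear isometry maps a set onto the preimage under its inverse. [folklore] -/
private theorem mem_image_linearIsometryEquiv_iff' (g : V ≃ₗᵢ[ℝ] V) (S : Set V) (z : V) :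
    z ∈ g '' S ↔ g.symm z ∈ S := by
  constructor
  · rintro ⟨x, hx, rfl⟩; simpa using hx
  · intro hz; exact ⟨g.symm z, hz, by simp⟩

omit [FiniteDimensional ℝ V] [MeasurableSpace V] [BorelSpace V] in
/-- The support of the pulled-back field `g⁻¹ ∘ ψ ∘ g` lies in `U` when the support of `ψ` lies in
`g U`. [folklore] -/
private theorem tsupport_conj_subset (g : V ≃ₗᵢ[ℝ] V) {ψ : V → V} {U : Set V}
    (hU : tsupport ψ ⊆ g '' U) : tsupport (fun x => g.symm (ψ (g x))) ⊆ U := by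
  have h1 : (fun x => g.symm (ψ (g x))) = (fun v => g.symm v) ∘ (ψ ∘ g.toHomeomorph) := rfl
  rw [h1, tsupport_comp_eq (g := fun v => g.symm v) (by intro x; simp) (ψ ∘ g.toHomeomorph),
    tsupport_comp_eq_preimage]
  intro x hx
  have hx' : g x ∈ g '' U := hU hx
  have h2 : g.symm (g x) ∈ U := (mem_image_linearIsometryEquiv_iff' g U (g x)).1 hx'
  simpa using h2

/-- One inequality of isometry covariance. [cite: Maggi2012, Exercise 12.11 p. 123] -/
private theorem anisotropicPerimeterIn_image_le (g : V ≃ₗᵢ[ℝ] V) (K A U : Set V) :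
    anisotropicPerimeterIn (g '' K) (g '' A) (g '' U) ≤ anisotropicPerimeterIn K A U := by
  refine anisotropicPerimeterIn_le_iff.2 fun ψ h₁ h₂ h₃ h₄ => ?_
  -- pull the field back: `φ = g⁻¹ ∘ ψ ∘ g`
  set φ : V → V := fun x => g.symm (ψ (g x)) with hφ
  have hφ₁ : ContDiff ℝ 1 φ :=
    (g.symm.toContinuousLinearEquiv.contDiff).comp (h₁.comp g.toContinuousLinearEquiv.contDiff)
  have hφ₂ : HasCompactSupport φ := by
    have h := h₂.comp_homeomorph g.toContinuousLinearEquiv.toHomeomorph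
    exact h.comp_left (g := fun v => g.symm v) (map_zero _)
  have hφ₃ : ∀ x, φ x ∈ K := fun x => by
    have := h₃ (g x)
    exact (mem_image_linearIsometryEquiv_iff' g K _).1 this
  have hφ₄ : tsupport φ ⊆ U := tsupport_conj_subset g h₄
  have hmp : MeasurePreserving (g : V → V) volume volume := g.measurePreserving
  have hme : MeasurableEmbedding (g : V → V) :=
    g.toContinuousLinearEquiv.toHomeomorph.measurableEmbedding
  have hint : ∫ x in g '' A, fieldDivergence ψ x = ∫ y in A, fieldDivergence φ y := by
    rw [hmp.setIntegral_image_emb hme]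
    refine integral_congr_ae (Eventually.of_forall fun y => ?_)
    rw [hφ, fieldDivergence_conj]
  rw [hint]
  exact le_anisotropicPerimeterIn hφ₁ hφ₂ hφ₃ hφ₄

/-- **Covariance of the localized perimeter under linear isometries: `P_{gK}(gA; gU) = P_K(A; U)`.**
[cite: Maggi2012, Exercise 12.11 p. 123 (with (20.2) p. 258 for general integrands)] -/
theorem anisotropicPerimeterIn_image_linearIsometryEquiv (g : V ≃ₗᵢ[ℝ] V) (K A U : Set V) :
    anisotropicPerimeterIn (g '' K) (g '' A) (g '' U) = anisotropicPerimeterIn K A U := by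
  refine le_antisymm (anisotropicPerimeterIn_image_le g K A U) ?_
  have h := anisotropicPerimeterIn_image_le g.symm (g '' K) (g '' A) (g '' U)
  have e : ∀ S : Set V, g.symm '' (g '' S) = S := fun S => by
    rw [Set.image_image]; simp
  rwa [e, e, e] at h

/-- Isometry invariance for a body invariant under `g` (a ball; the fcc Wulff body under its point
group): `P_K(gA; gU) = P_K(A; U)` when `g '' K = K`. [cite: Maggi2012, Exercise 12.11 p. 123] -/
theorem anisotropicPerimeterIn_image_linearIsometryEquiv_of_image_eq (g : V ≃ₗᵢ[ℝ] V)
    {K : Set V} (hK : g '' K = K) (A U : Set V) :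
    anisotropicPerimeterIn K (g '' A) (g '' U) = anisotropicPerimeterIn K A U := by
  conv_lhs => rw [← hK]
  exact anisotropicPerimeterIn_image_linearIsometryEquiv g K A U

omit [InnerProductSpace ℝ V] [FiniteDimensional ℝ V] [MeasurableSpace V] [BorelSpace V] in
/-- The image under a rigid motion `x ↦ g x + u` is the translate of the image under `g`. [folklore] -/
private theorem image_rigidMotion_eq {W : Type*} (g : W → V) (u : V) (S : Set W) :
    (fun x => g x + u) '' S = u +ᵥ (g '' S) := by
  ext y
  simp only [Set.mem_image, Set.mem_vadd_set, vadd_eq_add]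
  constructor
  · rintro ⟨x, hx, rfl⟩; exact ⟨g x, ⟨x, hx, rfl⟩, add_comm _ _⟩
  · rintro ⟨_, ⟨x, hx, rfl⟩, rfl⟩; exact ⟨x, hx, add_comm _ _⟩

/-- **Rigid motions**: for `x ↦ g x + u` (`g` a linear isometry), `P_{gK}(gA + u; gU + u) = P_K(A; U)`.
[cite: Maggi2012, Exercises 12.8 and 12.11 p. 123] -/
theorem anisotropicPerimeterIn_rigidMotion (g : V ≃ₗᵢ[ℝ] V) (u : V) (K A U : Set V) :
    anisotropicPerimeterIn (g '' K) ((fun x => g x + u) '' A) ((fun x => g x + u) '' U) =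
      anisotropicPerimeterIn K A U := by
  rw [image_rigidMotion_eq, image_rigidMotion_eq, anisotropicPerimeterIn_vadd,
    anisotropicPerimeterIn_image_linearIsometryEquiv]

/-- Rigid motions with a `g`-invariant body: `P_K(gA + u; gU + u) = P_K(A; U)` when `g '' K = K`.
[cite: Maggi2012, Exercises 12.8 and 12.11 p. 123] -/
theorem anisotropicPerimeterIn_rigidMotion_of_image_eq (g : V ≃ₗᵢ[ℝ] V) (u : V) {K : Set V}
    (hK : g '' K = K) (A U : Set V) :
    anisotropicPerimeterIn K ((fun x => g x + u) '' A) ((fun x => g x + u) '' U) =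
      anisotropicPerimeterIn K A U := by
  conv_lhs => rw [← hK]
  exact anisotropicPerimeterIn_rigidMotion g u K A U

/-! ### Dilations -/

omit [FiniteDimensional ℝ V] [MeasurableSpace V] [BorelSpace V] in
/-- On the zero space every divergence vanishes. [folklore] -/
private theorem fieldDivergence_of_subsingleton' [Subsingleton V] (θ : V → V) (x : V) :
    fieldDivergence θ x = 0 := by
  unfold fieldDivergence
  rw [Subsingleton.elim (fderiv ℝ θ x) 0]
  simp

omit [InnerProductSpace ℝ V] [FiniteDimensional ℝ V] [MeasurableSpace V] [BorelSpace V] in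
/-- The support of `φ(r ·)` lies in `U` when the support of `φ` lies in `r U` (`r ≠ 0`). [folklore] -/
private theorem tsupport_comp_smul_subset [NormedSpace ℝ V] {φ : V → V} {U : Set V} {r : ℝ}
    (hr : r ≠ 0) (hU : tsupport φ ⊆ r • U) : tsupport (fun y => φ (r • y)) ⊆ U := by
  have h : (fun y => φ (r • y)) = φ ∘ (Homeomorph.smulOfNeZero r hr) := rfl
  rw [h, tsupport_comp_eq_preimage]
  intro y hy
  have hy' : r • y ∈ r • U := hU hy
  rwa [Set.smul_mem_smul_set_iff₀ hr] at hy'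

/-- One inequality of the dilation law. [cite: Maggi2012, Exercise 12.8 p. 123] -/
private theorem anisotropicPerimeterIn_smul_le (K A U : Set V) {r : ℝ} (hr : 0 < r) :
    anisotropicPerimeterIn K (r • A) (r • U) ≤
      ENNReal.ofReal (r ^ (Module.finrank ℝ V - 1)) * anisotropicPerimeterIn K A U := by
  refine anisotropicPerimeterIn_le_iff.2 fun φ h₁ h₂ h₃ h₄ => ?_
  rcases Nat.eq_zero_or_pos (Module.finrank ℝ V) with hd0 | hdpos
  · -- the zero space: all divergences vanish
    haveI : Subsingleton V := Module.finrank_zero_iff.1 hd0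
    simp [fieldDivergence_of_subsingleton']
  -- rescaled field `ψ(y) = φ(r y)`
  have hψ₁ : ContDiff ℝ 1 fun y => φ (r • y) := h₁.comp (contDiff_const_smul r)
  have hψ₂ : HasCompactSupport fun y => φ (r • y) :=
    h₂.comp_homeomorph (Homeomorph.smulOfNeZero r hr.ne')
  have hψ₃ : ∀ y, (fun y => φ (r • y)) y ∈ K := fun y => h₃ _
  have hψ₄ : tsupport (fun y => φ (r • y)) ⊆ U := tsupport_comp_smul_subset hr.ne' h₄
  -- change of variables `x = r y`
  have hint : ∫ x in r • A, fieldDivergence φ x =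
      r ^ (Module.finrank ℝ V - 1) * ∫ y in A, fieldDivergence (fun y => φ (r • y)) y := by
    have hcv := Measure.setIntegral_comp_smul_of_pos volume (fun x => fieldDivergence φ x) A hr
    have hrd : (0 : ℝ) < r ^ Module.finrank ℝ V := pow_pos hr _
    have h1 : ∫ x in r • A, fieldDivergence φ x =
        r ^ Module.finrank ℝ V * ∫ y in A, fieldDivergence φ (r • y) := by
      rw [hcv, smul_eq_mul, ← mul_assoc, mul_inv_cancel₀ hrd.ne', one_mul]
    have h2 : ∫ y in A, fieldDivergence (fun y => φ (r • y)) y =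
        r * ∫ y in A, fieldDivergence φ (r • y) := by
      rw [← integral_const_mul]
      refine integral_congr_ae (Eventually.of_forall fun y => ?_)
      rw [fieldDivergence_comp_smul]
    rw [h1, h2, ← mul_assoc, ← pow_succ, Nat.sub_add_cancel hdpos]
  rw [hint, ENNReal.ofReal_mul (pow_nonneg hr.le _)]
  gcongr
  exact le_anisotropicPerimeterIn hψ₁ hψ₂ hψ₃ hψ₄

/-- **Dilation law for the localized perimeter: `P_K(rA; rU) = r^{d−1} P_K(A; U)`** (`r > 0`,
`d = dim V`). [cite: Maggi2012, Exercise 12.8 p. 123] -/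
theorem anisotropicPerimeterIn_smul (K A U : Set V) {r : ℝ} (hr : 0 < r) :
    anisotropicPerimeterIn K (r • A) (r • U) =
      ENNReal.ofReal (r ^ (Module.finrank ℝ V - 1)) * anisotropicPerimeterIn K A U := by
  refine le_antisymm (anisotropicPerimeterIn_smul_le K A U hr) ?_
  have h := anisotropicPerimeterIn_smul_le K (r • A) (r • U) (inv_pos.2 hr)
  rw [inv_smul_smul₀ hr.ne', inv_smul_smul₀ hr.ne'] at h
  calc ENNReal.ofReal (r ^ (Module.finrank ℝ V - 1)) * anisotropicPerimeterIn K A U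
      ≤ ENNReal.ofReal (r ^ (Module.finrank ℝ V - 1)) *
          (ENNReal.ofReal (r⁻¹ ^ (Module.finrank ℝ V - 1)) *
            anisotropicPerimeterIn K (r • A) (r • U)) := by
        gcongr
    _ = anisotropicPerimeterIn K (r • A) (r • U) := by
        rw [← mul_assoc, ← ENNReal.ofReal_mul (pow_nonneg hr.le _), ← mul_pow,
          mul_inv_cancel₀ hr.ne', one_pow, ENNReal.ofReal_one, one_mul]

end Literature.Analysis.Convexity

end
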